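import Mathlib
import HarnessLib
import Summits.ValiantsHypothesis.ValiantsHypothesis.Theorems.EquivariantDialLayers

/-!
# Equivariant-dc dial, LAYERED notch — first rung of the leaf: the equivariant ideal width at the cut
# `d = 1` is at most the number of variables (decomp-valiant workshop, lens 1, generation 14) — support file

HONEST FRAMING.  `VP ≠ VNP` is NOT proved here.  This small support file of the census cell
`A = EquivariantDialNode.EqHardBiPerm` (item `stmt-ValiantsHypothesis-23702`, supported, not closed) decides the
cheapest instance of the instrumentable leaf `IdealWidthSuperpoly` of `EquivariantDialLayers`: at the cut
`d = 1` the `Γ`-equivariant ideal width of ANY polynomial without constant term is at most the number of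
variables, for EVERY symmetry group `Γ` (the span of all variables is stable under every linear
substitution; a form of positive degree has no constant term), so `idealWidth (H m) per_m 1 ≤ m²` and the leaf can only be witnessed at cuts `d ≥ 2`.
(g13's paper layer-1 theorem `r_window(m,1) = m²` says this rung is tight for the bi-permutation window; only
the upper bound is formalised.)

* `hasIdealWidthLE_one_of_constantCoeff` — `constantCoeff f = 0 → HasIdealWidthLE Γ f 1 (card σ)`;
  `hasIdealWidthLE_one_of_isHomogeneous` — the same for a form of degree `n ≥ 1`;
* `hasIdealWidthLE_perPoly_one`, `idealWidth_perPoly_one_le` — `idealWidth Γ per_m 1 ≤ m ^ 2` (`1 ≤ m`);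
* `not_idealWidthSuperpoly_witness_one` — for `1 ≤ m`, `2 ≤ c`: `¬ (m ^ c + c < idealWidth (H m) per_m 1)`.
-/

set_option linter.dupNamespace false

namespace Summit.ValiantsHypothesis.ValiantsHypothesis.Theorems.EquivariantDialLayers

open MvPolynomial Matrix Literature.Computability.AlgebraicComplexity

noncomputable section

section DegOne

variable {σ : Type*} {k : Type*} [CommRing k] [Fintype σ] [DecidableEq σ]

/-- **Rung `d = 1`.** A polynomial without constant term is cut in degree `1` by the span of ALL variables,
which is stable under every linear substitution: `HasIdealWidthLE Γ f 1 (card σ)` for every `Γ`. -/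
theorem hasIdealWidthLE_one_of_constantCoeff (Γ : Subgroup (GL σ k)) {f : MvPolynomial σ k}
    (hf : constantCoeff f = 0) : HasIdealWidthLE Γ f 1 (Fintype.card σ) := by
  classical
  refine ⟨Finset.univ.image (X : σ → MvPolynomial σ k), Finset.card_image_le.trans (by simp), ?_, ?_, ?_⟩
  · intro p hp
    obtain ⟨i, -, rfl⟩ := Finset.mem_image.mp hp
    exact isHomogeneous_X k i
  · intro γ _ p hp
    obtain ⟨i, -, rfl⟩ := Finset.mem_image.mp hp
    rw [linSubst, aeval_X]
    refine Submodule.sum_mem _ fun j _ => Submodule.smul_mem _ _ (Submodule.subset_span ?_)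
    exact Finset.mem_coe.mpr (Finset.mem_image.mpr ⟨j, Finset.mem_univ _, rfl⟩)
  · rw [Finset.coe_image, Finset.coe_univ, mem_ideal_span_X_image]
    intro d hd
    by_contra h
    have hd0 : d = 0 := Finsupp.ext fun i => by
      by_contra hi
      exact h ⟨i, Set.mem_univ _, hi⟩
    subst hd0
    rw [mem_support_iff, ← constantCoeff_eq] at hd
    exact hd hf

/-- A form of positive degree is cut in degree `1` by the span of all variables, for every `Γ`. -/
theorem hasIdealWidthLE_one_of_isHomogeneous (Γ : Subgroup (GL σ k)) {f : MvPolynomial σ k} {n : ℕ}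
    (hf : f.IsHomogeneous n) (hn : 1 ≤ n) : HasIdealWidthLE Γ f 1 (Fintype.card σ) := by
  refine hasIdealWidthLE_one_of_constantCoeff Γ ?_
  rw [constantCoeff_eq, hf.coeff_eq_zero]
  rw [map_zero]
  omega

/-- `per_m` (`m ≥ 1`) is cut in degree `1` by its `m²` variables, equivariantly for every `Γ`. -/
theorem hasIdealWidthLE_perPoly_one {m : ℕ} (Γ : Subgroup (GL (Fin m × Fin m) ℂ)) (hm : 1 ≤ m) :
    HasIdealWidthLE Γ (perPoly (Fin m) ℂ) 1 (m ^ 2) := by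
  have h := hasIdealWidthLE_one_of_isHomogeneous Γ (perPoly_isHomogeneous (n := Fin m) (k := ℂ))
    (by rw [Fintype.card_fin]; exact hm)
  simpa [Fintype.card_prod, Fintype.card_fin, sq] using h

/-- Hence `idealWidth Γ per_m 1 ≤ m²` for every symmetry group `Γ` (`m ≥ 1`). -/
theorem idealWidth_perPoly_one_le {m : ℕ} (Γ : Subgroup (GL (Fin m × Fin m) ℂ)) (hm : 1 ≤ m) :
    idealWidth Γ (perPoly (Fin m) ℂ) 1 ≤ m ^ 2 :=
  idealWidth_le (hasIdealWidthLE_perPoly_one Γ hm)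

/-- **The leaf is not witnessed at the cut `d = 1`:** for `m ≥ 1` and any exponent `c ≥ 2`, the
`H m`-equivariant ideal width of `per_m` in degree `1` does not exceed `m ^ c + c`. -/
theorem not_idealWidthSuperpoly_witness_one (H : ∀ m : ℕ, Subgroup (GL (Fin m × Fin m) ℂ)) {m c : ℕ}
    (hm : 1 ≤ m) (hc : 2 ≤ c) : ¬ (m ^ c + c < idealWidth (H m) (perPoly (Fin m) ℂ) 1) := by
  have h1 := idealWidth_perPoly_one_le (H m) hm
  have h2 : m ^ 2 ≤ m ^ c := Nat.pow_le_pow_right hm hc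
  omega

end DegOne

end

end Summit.ValiantsHypothesis.ValiantsHypothesis.Theorems.EquivariantDialLayers
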